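/-
Copyright (c) 2026. Released under Apache 2.0 license as described in the file LICENSE.
Track B ∕ K2-LIT (cell `hodgecm-mathlib`, squad K2, ENGINE E1), crux h413 = `stmt-HodgeConjecture-24833`, route of record `HCCMUnconditional`.
Prover seat `hodgecm-mathlib-K2E3-p12` (g6).  Deal (ρ1) G8a (K2E1-plan (g5) 08:28:39Z; (δ) JUNCTION MEMO fe64988a §3 G8(a)).
-/
import Summits.HodgeConjecture.HodgeConjecture.Theorems.K2E1UnitaryDetCharacterLines   -- ★ rung 4 (K2E1-p09 g2): universal family, `χ ∘ det`; brings ★ rung 3 `K2E1ResidualCompactOfCharacters`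
import HarnessLib

/-!
# K2·E1 — `K2E1CharacterLinesCompactU2`: G8(a) BY NAME — `R(f)` IS COMPACT ON THE CLOSED SPAN `V` OF THE AUTOMORPHIC CHARACTER LINES (every `f ∈ C_c(G(𝔸))`,
# every Haar `η`), UNCONDITIONALLY — the clause-shaped half of 5Res :247 `CmResidualSpectrumCompact L 2 μ`, independent of Eisenstein theory

Track B ∕ K2-LIT, crux h413 = `stmt-HodgeConjecture-24833`, route of record `HCCMUnconditional`; cell `hodgecm-mathlib`, squad K2, ENGINE E1.  Prover seat `hodgecm-mathlib-K2E3-p12` (g6).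
THEOREMS ONLY (no `def`, no `instance`, no notation, no named-fact hypothesis, no `sorry`); lane `--supports stmt-HodgeConjecture-24833 --as helper` (count-neutral).  Closes no socket.

CENSUS (honest): G8(a) of the junction memo (δ) — «`V :=` closed span of the character lines; `R(f)|_V` compact» — is ALREADY ★ IN SUBSTANCE: rungs 1–4 of K2E1-p09 (g2), 2026-09-03
(★ p855556 `K2E1DiagonalCharacterOperatorCompact`, ★ p855591 `K2E1CompactAbelianRiemannLebesgue`, ★ p855663 `K2E1ResidualCompactOfCharacters` §1 `isCompactOperator_apply_coe_of_le_closure_span`,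
§2 eigen-line law `integratedOperator_charLine` + orthogonality `inner_charLine_eq_zero`, §3 decay `tendsto_charCoeff_cofinite` by Weil unfolding + Bessel, §4 `residualSpectrumCompact_of_charLines`
MODULO `hres : L²_res ≤ V`; ★ `K2E1UnitaryDetCharacterLines` §A universal family, §B `χ ∘ det`).  What the tree states BY NAME is the `hres`-relative form (compactness on any `W ≤ V`);
this file records the ABSOLUTE clause G8(a) — compactness on `V` itself (`W := V`, `hres := le_rfl`) — so that 5Res = G8(b) ∘ G8(a) reads as two named theorems: NOTHING new mathematically.
THE MATHEMATICS [MoeglinWaldspurger1995, I.2.18; Rogawski1990, §13.5 pp. 204–206; ReedSimonI1980, Thm. VI.12–VI.13].  On the line `ℂ·[Φ_ω]` (`Φ_ω(gΓ) = ω(g)`, `ω` a continuous character of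
`G(𝔸)` trivial on `A_G G(K)`) `R(f)` acts by the scalar `∫ f·ω̄ dη`; distinct `ω` give orthogonal lines; the scalars tend to `0` along any injective family (unfolding + Bessel on `L²(X, μ)`);
a diagonal operator with a null sequence of eigenvalues on pairwise orthogonal lines is compact on their closed span.
§1 (any ★ `AdelicGroupData`) **`isCompactOperator_integratedOperator_closureSpan_charLines`**; §2 (the universal family of ALL automorphic characters) **`…_closureSpan_automorphicCharacters`**;
§3 (`U(Φ_N)` of a CM field, all `N`, hypothesis-free but for the descended-line data `Φ`) **`isCompactOperator_integratedOperator_closureSpan_automorphicCharacters_cm`**.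
HONEST LABEL: HC_CM is proved only modulo the 7 printed citations (2 remaining named inputs: hLiu418 = `stmt-HodgeConjecture-24832`, h413 = `stmt-HodgeConjecture-24833`) until rung 0
closes; this file asserts no named fact and closes no socket; 5Res itself still needs G8(b) `hres` (Langlands' exhaustion, XL).
References: [MoeglinWaldspurger1995] I.2.18, V.3.13 · [Rogawski1990] §13.5 pp. 204–206 · [ReedSimonI1980] Thm. VI.12–VI.13 · [GetzHahn2024] Thm. 3.2.2, Lemma 9.2.4.
-/

set_option autoImplicit false
-- the mandated namespace repeats the single-problem summit's segment (`HodgeConjecture.HodgeConjecture`)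
set_option linter.dupNamespace false

noncomputable section

open Filter Topology MeasureTheory Complex Submodule CompactlySupported NumberField
open scoped InnerProductSpace ComplexConjugate
open Literature.NumberTheory.Automorphic Literature.NumberTheory.Automorphic.UnitaryGroup
open Summit.HodgeConjecture.HodgeConjecture.Cruxes.H413.K2E1CuspidalSpectrumUnitary
open Summit.HodgeConjecture.HodgeConjecture.Cruxes.H413.K2E1ResidualCompactOfCharacters

namespace Summit.HodgeConjecture.HodgeConjecture.Cruxes.H413.K2E1CharacterLinesCompactU2

universe u

/-! ## §1 Any injective family of automorphic characters (general adelic group datum) -/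

section General

variable {K : Type} [Field K] [NumberField K] (𝒢 : AdelicGroupData.{u} K)
  (μ : Measure 𝒢.automorphicQuotient) [𝒢.IsAutomorphicMeasure μ]
  [LocallyCompactSpace 𝒢.Adelic] [SecondCountableTopology 𝒢.Adelic] [T2Space 𝒢.Adelic]

/-- **G8(a): `R(f)` IS COMPACT ON THE CLOSED SPAN OF THE CHARACTER LINES.**  Let `𝒢` be an adelic group datum with `G(𝔸)` locally compact second countable Hausdorff
and `A_G G(K)` closed, `μ` automorphic, `ω_i` an injective family of continuous characters of `G(𝔸)` trivial on `A_G G(K)` with descended lines `Φ_i`, and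
`V := closure (span {[Φ_i]})` in `L²(X, μ)`.  Then for every Borel structure, Haar measure `η` and `f ∈ C_c(G(𝔸))`, `w ↦ R(f) w : V → L²` is a compact operator
(★ rung 3 §1 at `W := V`, eigen-line law §2, decay §3). [cite: MoeglinWaldspurger1995, I.2.18] [cite: Rogawski1990, §13.5 pp. 204–206] [cite: ReedSimonI1980, Thm. VI.12–VI.13] -/
theorem isCompactOperator_integratedOperator_closureSpan_charLines (hQ : IsClosed (𝒢.quotientSubgroup : Set 𝒢.Adelic))
    {ι : Type*} {ω : ι → 𝒢.Adelic →* Circle} (hω : ∀ i, Continuous fun g => (ω i g : ℂ)) (hinj : Function.Injective ω)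
    (hωQ : ∀ i, ∀ γ ∈ 𝒢.quotientSubgroup, ω i γ = 1)
    (Φ : ι → 𝒢.automorphicQuotient → ℂ) (hΦ : ∀ i g, Φ i (𝒢.toAutomorphicQuotient g) = (ω i g : ℂ))
    [MeasurableSpace 𝒢.Adelic] [BorelSpace 𝒢.Adelic] (η : Measure 𝒢.Adelic) [η.IsHaarMeasure] (f : C_c(𝒢.Adelic, ℂ)) :
    IsCompactOperator fun w : (span ℂ (Set.range fun i => (memLp_charLine μ (hω i) (hΦ i)).toLp (Φ i))).topologicalClosure =>
      (𝒢.rightRegular μ).integratedOperator (𝒢.isUnitary_rightRegular μ) (𝒢.isStronglyContinuous_rightRegular_holds μ) η f (w : 𝒢.L2 μ) :=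
  isCompactOperator_apply_coe_of_le_closure_span (𝕜 := ℂ)
    (v := fun i => (memLp_charLine μ (hω i) (hΦ i)).toLp (Φ i))
    (fun i => charLine_toLp_ne_zero μ (hω i) (hΦ i))
    (fun i j hij => inner_charLine_eq_zero μ (hω i) (hΦ i) (hω j) (hΦ j) (hinj.ne hij))
    _ le_rfl _ (fun i => ∫ g, f g * conj (ω i g : ℂ) ∂η)
    (fun i => integratedOperator_charLine μ (hω i) (hΦ i) η f)
    (tendsto_charCoeff_cofinite 𝒢 μ hQ η hω hinj hωQ f)

/-- **G8(a) FOR THE UNIVERSAL FAMILY**: the same with `ι :=` ALL continuous characters of `G(𝔸)` trivial on `A_G G(K)` (injective tautologically) and any choice of descended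
lines — `R(f)` is compact on the closed span of ALL automorphic character lines. [cite: MoeglinWaldspurger1995, I.2.18] [cite: Rogawski1990, §13.5 pp. 204–206] -/
theorem isCompactOperator_integratedOperator_closureSpan_automorphicCharacters (hQ : IsClosed (𝒢.quotientSubgroup : Set 𝒢.Adelic))
    (Φ : {ω : 𝒢.Adelic →* Circle // Continuous (fun g => (ω g : ℂ)) ∧ ∀ γ ∈ 𝒢.quotientSubgroup, ω γ = 1} → 𝒢.automorphicQuotient → ℂ)
    (hΦ : ∀ i g, Φ i (𝒢.toAutomorphicQuotient g) = (i.1 g : ℂ))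
    [MeasurableSpace 𝒢.Adelic] [BorelSpace 𝒢.Adelic] (η : Measure 𝒢.Adelic) [η.IsHaarMeasure] (f : C_c(𝒢.Adelic, ℂ)) :
    IsCompactOperator fun w : (span ℂ (Set.range fun i => (memLp_charLine μ i.2.1 (hΦ i)).toLp (Φ i))).topologicalClosure =>
      (𝒢.rightRegular μ).integratedOperator (𝒢.isUnitary_rightRegular μ) (𝒢.isStronglyContinuous_rightRegular_holds μ) η f (w : 𝒢.L2 μ) :=
  isCompactOperator_integratedOperator_closureSpan_charLines 𝒢 μ hQ (ω := fun i => i.1) (fun i => i.2.1) Subtype.val_injective (fun i => i.2.2) Φ hΦ η f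

end General

/-! ## §2 The quasi-split unitary group `U(Φ_N)` of a CM field (all `N`) -/

section Unitary

variable (L : Type) [Field L] [NumberField L] [IsCMField L] (N : ℕ)
  (μ : Measure (cmDatum L N (Matrix.of fun i j : Fin N => if i.val + j.val + 1 = N then (1 : L) else 0)).automorphicQuotient)
  [(cmDatum L N (Matrix.of fun i j : Fin N => if i.val + j.val + 1 = N then (1 : L) else 0)).IsAutomorphicMeasure μ]

/-- **G8(a) FOR `U(Φ_N)_{L∕L⁺}`** (★ `cmDatum`: `A_G = ⊥`, `U(Φ_N)(L⁺)` closed ★ `isClosed_cmDatum_quotientSubgroup`, `U(Φ_N)(𝔸_{L⁺})` locally compact second countable Hausdorff ★):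
for ALL automorphic characters `ω` of `U(Φ_N)(𝔸_{L⁺})` (print: `ω = χ̃ ∘ det`, `χ̃` the automorphic characters of `U(1)`; ★ `charDet_mem_universalFamily`) with descended lines `Φ_ω`,
`R(f)` is compact on `V :=` the closed span of the `[Φ_ω]`, for every Haar `η` and `f ∈ C_c`.  With G8(b) `cmResidualSubspace L N μ ≤ V` (Langlands, NOT proved) this is 5Res ∕ 12R3
(★ `residualSpectrumCompact_of_span_automorphicCharacters`). [cite: Rogawski1990, §13.5 pp. 204–206] [cite: MoeglinWaldspurger1995, I.2.18 and V.3.13] -/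
theorem isCompactOperator_integratedOperator_closureSpan_automorphicCharacters_cm
    (Φ : {ω : (cmDatum L N (Matrix.of fun i j : Fin N => if i.val + j.val + 1 = N then (1 : L) else 0)).Adelic →* Circle //
        Continuous (fun g => (ω g : ℂ)) ∧
          ∀ γ ∈ (cmDatum L N (Matrix.of fun i j : Fin N => if i.val + j.val + 1 = N then (1 : L) else 0)).quotientSubgroup, ω γ = 1} →
      (cmDatum L N (Matrix.of fun i j : Fin N => if i.val + j.val + 1 = N then (1 : L) else 0)).automorphicQuotient → ℂ)
    (hΦ : ∀ i g, Φ i ((cmDatum L N (Matrix.of fun i j : Fin N => if i.val + j.val + 1 = N then (1 : L) else 0)).toAutomorphicQuotient g) = (i.1 g : ℂ))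
    [MeasurableSpace (cmDatum L N (Matrix.of fun i j : Fin N => if i.val + j.val + 1 = N then (1 : L) else 0)).Adelic]
    [BorelSpace (cmDatum L N (Matrix.of fun i j : Fin N => if i.val + j.val + 1 = N then (1 : L) else 0)).Adelic]
    (η : Measure (cmDatum L N (Matrix.of fun i j : Fin N => if i.val + j.val + 1 = N then (1 : L) else 0)).Adelic) [η.IsHaarMeasure]
    (f : C_c((cmDatum L N (Matrix.of fun i j : Fin N => if i.val + j.val + 1 = N then (1 : L) else 0)).Adelic, ℂ)) :
    IsCompactOperator fun w : (span ℂ (Set.range fun i => (memLp_charLine μ i.2.1 (hΦ i)).toLp (Φ i))).topologicalClosure =>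
      ((cmDatum L N (Matrix.of fun i j : Fin N => if i.val + j.val + 1 = N then (1 : L) else 0)).rightRegular μ).integratedOperator
        ((cmDatum L N (Matrix.of fun i j : Fin N => if i.val + j.val + 1 = N then (1 : L) else 0)).isUnitary_rightRegular μ)
        ((cmDatum L N (Matrix.of fun i j : Fin N => if i.val + j.val + 1 = N then (1 : L) else 0)).isStronglyContinuous_rightRegular_holds μ) η f
        (w : (cmDatum L N (Matrix.of fun i j : Fin N => if i.val + j.val + 1 = N then (1 : L) else 0)).L2 μ) :=
  isCompactOperator_integratedOperator_closureSpan_automorphicCharacters _ μ (isClosed_cmDatum_quotientSubgroup L N _) Φ hΦ η f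

end Unitary

end Summit.HodgeConjecture.HodgeConjecture.Cruxes.H413.K2E1CharacterLinesCompactU2

end
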